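import Mathlib.Topology.Algebra.MvPolynomial
import Mathlib.LinearAlgebra.LinearIndependent.Lemmas
import Literature.NumberTheory.Transcendental.CurvePeriods
import Literature.NumberTheory.Transcendental.CurvePeriodsGmLoopsProofs
import Literature.NumberTheory.Transcendental.CurvePeriodsAffineLineProofs
import Literature.NumberTheory.Transcendental.KZSemialgebraicComplex
import Literature.NumberTheory.Transcendental.KZPeriodsProofs
import Literature.FieldTheory.AlgClosed.PuiseuxImplicitRoot

/-!
# Étale graph curves `Z_G ⊂ ℂ³` (Rung 2, file E3a)

Solo programme `solo-KontsevichZagierPeriods-informed`, step L4 of `paper/rung2-v2.md`. For a field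
`K ⊂ ℂ` of algebraic numbers and `G, H ∈ K[s][Y]` we build the Huber–Wüstholz period symbol
`(Z_G, H ds, γ)` where

* `Z_G = {(x₀, x₁, x₂) ∈ ℂ³ | G(x₀, x₁) = 0, x₂ · ∂_Y G(x₀, x₁) = 1}` is the ÉTALE LOCUS of the plane
  curve `G = 0` over the `s`-line, made affine by the extra coordinate `x₂ = 1/∂_Y G`; it is a smooth
  affine curve over `ℚ̄` in the embedded sense of `CurveData.IsSmoothAffineCurve` (Jacobian rank `2`
  everywhere, no isolated points by the holomorphic implicit function theorem);
* `γ(t) = (s(t), Y(t), 1/∂_Y G(s(t), Y(t)))` for `C¹` functions `s, Y` with `G(s, Y) = 0`,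
  `∂_Y G(s, Y) ≠ 0` on a neighbourhood of `[0, 1]` and algebraic end points;

(the path and the symbol are built in file E3b, `SoloInformedEtaleSymbol.lean`). This file: the
passage `K[s][Y] → ℂ[x₀, x₁, x₂]`, complex evaluation, partial derivatives, algebraic coefficients,
and the smoothness of `Z_G`. [Huber–Wüstholz 2022, Def. 12.6, §13.1; folklore]
-/

noncomputable section

open Set Filter Topology
open scoped Polynomial
open Literature.NumberTheory.Transcendental Literature.NumberTheory.Transcendental.CurvePeriods
open Literature.ModelTheory.ExponentialFields Literature.FieldTheory.AlgClosed

namespace Summit.KontsevichZagierPeriods.KontsevichZagierPeriods.Theorems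

variable {K : Type*} [Field K] [Algebra K ℂ]

/-! ## 1. Bivariate polynomials over `K` as complex polynomials in three variables -/

/-- The inner map `K[s] → ℂ[x₀, x₁, x₂]`, `s ↦ x₀`. -/
def soloInformedToMv3Inner : K[X] →+* MvPolynomial (Fin 3) ℂ :=
  Polynomial.eval₂RingHom (MvPolynomial.C.comp (algebraMap K ℂ)) (MvPolynomial.X 0)

/-- The map `K[s][Y] → ℂ[x₀, x₁, x₂]`, `s ↦ x₀`, `Y ↦ x₁`. -/
def soloInformedToMv3Hom : K[X][X] →+* MvPolynomial (Fin 3) ℂ :=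
  Polynomial.eval₂RingHom soloInformedToMv3Inner (MvPolynomial.X 1)

/-- The image of `G ∈ K[s][Y]` in `ℂ[x₀, x₁, x₂]`. -/
def soloInformedToMv3 (G : K[X][X]) : MvPolynomial (Fin 3) ℂ := soloInformedToMv3Hom G

/-- The complex evaluation hom `G ↦ G(s, W)`. -/
def soloInformedEvCHom (s W : ℂ) : K[X][X] →+* ℂ :=
  (Polynomial.evalRingHom W).comp (Polynomial.mapRingHom (Polynomial.eval₂RingHom (algebraMap K ℂ) s))

/-- The complex evaluation `G(s, W)` (the convention of the tree's Puiseux files). -/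
def soloInformedEvC (G : K[X][X]) (s W : ℂ) : ℂ :=
  (G.map (Polynomial.eval₂RingHom (algebraMap K ℂ) s)).eval W

/-- `G(s, W)` is the evaluation hom applied to `G`. -/
theorem soloInformedEvCHom_apply (G : K[X][X]) (s W : ℂ) :
    soloInformedEvCHom s W G = soloInformedEvC G s W := rfl

/-- Evaluation of the inner image: `x₀ ↦ z₀`. -/
theorem soloInformed_eval_toMv3Inner (a : K[X]) (z : Fin 3 → ℂ) :
    MvPolynomial.eval z (soloInformedToMv3Inner a) = Polynomial.eval₂ (algebraMap K ℂ) (z 0) a := by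
  induction a using Polynomial.induction_on' with
  | add p q hp hq => simp only [map_add, hp, hq, Polynomial.eval₂_add]
  | monomial n c =>
    rw [soloInformedToMv3Inner, Polynomial.coe_eval₂RingHom, Polynomial.eval₂_monomial,
      Polynomial.eval₂_monomial, map_mul, map_pow, RingHom.comp_apply, MvPolynomial.eval_C,
      MvPolynomial.eval_X]

/-- **`(toMv3 G)(z) = G(z₀, z₁)`.** -/
theorem soloInformed_eval_toMv3 (G : K[X][X]) (z : Fin 3 → ℂ) :
    MvPolynomial.eval z (soloInformedToMv3 G) = soloInformedEvC G (z 0) (z 1) := by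
  rw [← soloInformedEvCHom_apply, soloInformedToMv3]
  induction G using Polynomial.induction_on' with
  | add p q hp hq => simp only [map_add, hp, hq]
  | monomial n c =>
    rw [← Polynomial.C_mul_X_pow_eq_monomial, map_mul, map_pow, map_mul, map_pow, map_mul, map_pow]
    have hC : MvPolynomial.eval z (soloInformedToMv3Hom (Polynomial.C c)) =
        soloInformedEvCHom (z 0) (z 1) (Polynomial.C c) := by
      rw [soloInformedToMv3Hom, Polynomial.coe_eval₂RingHom, Polynomial.eval₂_C,
        soloInformed_eval_toMv3Inner]
      simp only [soloInformedEvCHom, RingHom.comp_apply, Polynomial.coe_mapRingHom, Polynomial.map_C,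
        Polynomial.coe_evalRingHom, Polynomial.eval_C, Polynomial.coe_eval₂RingHom]
    have hX : MvPolynomial.eval z (soloInformedToMv3Hom (Polynomial.X : K[X][X])) =
        soloInformedEvCHom (z 0) (z 1) (Polynomial.X : K[X][X]) := by
      rw [soloInformedToMv3Hom, Polynomial.coe_eval₂RingHom, Polynomial.eval₂_X, MvPolynomial.eval_X]
      simp only [soloInformedEvCHom, RingHom.comp_apply, Polynomial.coe_mapRingHom, Polynomial.map_X,
        Polynomial.coe_evalRingHom, Polynomial.eval_X]
    rw [hC, hX]

/-- The inner image does not involve `x₁`, `x₂`. -/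
theorem soloInformed_pderiv_toMv3Inner (a : K[X]) {i : Fin 3} (hi : i ≠ 0) :
    MvPolynomial.pderiv i (soloInformedToMv3Inner a) = 0 := by
  induction a using Polynomial.induction_on' with
  | add p q hp hq => simp only [map_add, hp, hq, add_zero]
  | monomial n c =>
    rw [soloInformedToMv3Inner, Polynomial.coe_eval₂RingHom, Polynomial.eval₂_monomial]
    simp [MvPolynomial.pderiv_X, Pi.single_eq_of_ne hi.symm]

/-- **`∂_{x₁}` of the image is the image of `∂_Y`.** -/
theorem soloInformed_pderiv_one_toMv3 (G : K[X][X]) :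
    MvPolynomial.pderiv 1 (soloInformedToMv3 G) = soloInformedToMv3 (Polynomial.derivative G) := by
  rw [soloInformedToMv3, soloInformedToMv3]
  induction G using Polynomial.induction_on' with
  | add p q hp hq => simp only [map_add, hp, hq]
  | monomial n c =>
    rw [Polynomial.derivative_monomial, ← Polynomial.C_mul_X_pow_eq_monomial,
      ← Polynomial.C_mul_X_pow_eq_monomial]
    simp only [map_mul, map_pow, soloInformedToMv3Hom, Polynomial.coe_eval₂RingHom,
      Polynomial.eval₂_C, Polynomial.eval₂_X, Derivation.leibniz, Derivation.leibniz_pow,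
      MvPolynomial.pderiv_X, soloInformed_pderiv_toMv3Inner c one_ne_zero,
      Pi.single_eq_same, smul_eq_mul, mul_one, map_natCast]
    rcases n with _ | n
    · simp
    · rw [Nat.add_sub_cancel]
      push_cast
      ring

/-- The image does not involve `x₂`. -/
theorem soloInformed_pderiv_two_toMv3 (G : K[X][X]) :
    MvPolynomial.pderiv 2 (soloInformedToMv3 G) = 0 := by
  rw [soloInformedToMv3]
  induction G using Polynomial.induction_on' with
  | add p q hp hq => simp only [map_add, hp, hq, add_zero]
  | monomial n c =>
    rw [← Polynomial.C_mul_X_pow_eq_monomial]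
    have h12 : (2 : Fin 3) ≠ 0 := by decide
    simp only [map_mul, map_pow, soloInformedToMv3Hom, Polynomial.coe_eval₂RingHom,
      Polynomial.eval₂_C, Polynomial.eval₂_X, Derivation.leibniz, Derivation.leibniz_pow,
      MvPolynomial.pderiv_X, soloInformed_pderiv_toMv3Inner c h12, smul_zero, add_zero,
      Pi.single_eq_of_ne (show (1 : Fin 3) ≠ 2 by decide)]

/-- **Algebraic coefficients.** If `K` consists of algebraic numbers, the image of `G` has
algebraic coefficients. -/
theorem soloInformed_hasAlgCoeffs_toMv3 (hK : ∀ a : K, IsAlgebraic ℚ (algebraMap K ℂ a))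
    (G : K[X][X]) : HasAlgCoeffs (soloInformedToMv3 G) := by
  have hin : ∀ a : K[X], HasAlgCoeffs (soloInformedToMv3Inner a) := by
    intro a
    induction a using Polynomial.induction_on' with
    | add p q hp hq => rw [map_add]; exact hp.add hq
    | monomial n c =>
      rw [soloInformedToMv3Inner, Polynomial.coe_eval₂RingHom, Polynomial.eval₂_monomial]
      exact (hasAlgCoeffs_C (hK c)).mul ((hasAlgCoeffs_X 0).pow n)
  rw [soloInformedToMv3]
  induction G using Polynomial.induction_on' with
  | add p q hp hq => rw [map_add]; exact hp.add hq
  | monomial n a =>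
    rw [soloInformedToMv3Hom, Polynomial.coe_eval₂RingHom, Polynomial.eval₂_monomial]
    exact (hin a).mul ((hasAlgCoeffs_X 1).pow n)

/-- `G(s, W)` at algebraic `s, W` is algebraic (when `K` consists of algebraic numbers). -/
theorem soloInformed_isAlgebraic_evC (hK : ∀ a : K, IsAlgebraic ℚ (algebraMap K ℂ a))
    (G : K[X][X]) {s W : ℂ} (hs : IsAlgebraic ℚ s) (hW : IsAlgebraic ℚ W) :
    IsAlgebraic ℚ (soloInformedEvC G s W) := by
  have h := (soloInformed_hasAlgCoeffs_toMv3 hK G).isAlgebraic_eval (z := ![s, W, 0])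
    (fun i => by fin_cases i <;> simp [hs, hW, isAlgebraic_zero])
  rwa [soloInformed_eval_toMv3] at h

/-- `(s, W) ↦ G(s, W)` is continuous. -/
theorem soloInformed_continuous_evC (G : K[X][X]) :
    Continuous fun p : ℂ × ℂ => soloInformedEvC G p.1 p.2 := by
  have h : (fun p : ℂ × ℂ => soloInformedEvC G p.1 p.2) =
      (fun z => MvPolynomial.eval z (soloInformedToMv3 G)) ∘ fun p : ℂ × ℂ => ![p.1, p.2, 0] := by
    funext p
    simp [soloInformed_eval_toMv3]
  rw [h]
  refine (MvPolynomial.continuous_eval _).comp (continuous_pi fun i => ?_)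
  fin_cases i
  · simpa using continuous_fst
  · simpa using continuous_snd
  · simpa using continuous_const

/-- `(s, W) ↦ G(s, W)` is real-`C^n`. -/
theorem soloInformed_contDiff_evC (G : K[X][X]) {n : WithTop ℕ∞} :
    ContDiff ℝ n fun p : ℂ × ℂ => soloInformedEvC G p.1 p.2 := by
  have h : (fun p : ℂ × ℂ => soloInformedEvC G p.1 p.2) =
      (fun z => MvPolynomial.eval z (soloInformedToMv3 G)) ∘ fun p : ℂ × ℂ => ![p.1, p.2, 0] := by
    funext p
    simp [soloInformed_eval_toMv3]
  rw [h]
  have h1 : ContDiff ℂ n fun z : Fin 3 → ℂ => MvPolynomial.eval z (soloInformedToMv3 G) :=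
    contDiff_iff_contDiffAt.2 fun z => contDiffAt_eval _ z
  refine (h1.restrict_scalars ℝ).comp (contDiff_pi.2 fun i => ?_)
  fin_cases i
  · simpa using contDiff_fst
  · simpa using contDiff_snd
  · simpa using contDiff_const

/-! ## 2. The étale graph curve `Z_G` -/

/-- **The étale graph curve** `Z_G = {G(x₀, x₁) = 0, x₂ · ∂_Y G(x₀, x₁) = 1} ⊂ ℂ³`. -/
abbrev soloInformedEtaleCurve (G : K[X][X]) : CurveData :=
  ⟨3, 2, ![soloInformedToMv3 G,
    MvPolynomial.X 2 * soloInformedToMv3 (Polynomial.derivative G) - 1]⟩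

/-- Points of `Z_G`. -/
theorem soloInformed_mem_etaleCurve (G : K[X][X]) (z : Fin 3 → ℂ) :
    z ∈ (soloInformedEtaleCurve G).points ↔ soloInformedEvC G (z 0) (z 1) = 0 ∧
      z 2 * soloInformedEvC (Polynomial.derivative G) (z 0) (z 1) = 1 := by
  show (∀ j, MvPolynomial.eval z ((soloInformedEtaleCurve G).F j) = 0) ↔ _
  rw [Fin.forall_fin_two]
  show MvPolynomial.eval z (soloInformedToMv3 G) = 0 ∧ MvPolynomial.eval z
    (MvPolynomial.X 2 * soloInformedToMv3 (Polynomial.derivative G) - 1) = 0 ↔ _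
  rw [soloInformed_eval_toMv3, map_sub, map_mul, MvPolynomial.eval_X, map_one, soloInformed_eval_toMv3,
    sub_eq_zero]

/-- On `Z_G`, `∂_Y G ≠ 0`. -/
theorem soloInformed_etale_of_mem {G : K[X][X]} {z : Fin 3 → ℂ}
    (hz : z ∈ (soloInformedEtaleCurve G).points) :
    soloInformedEvC (Polynomial.derivative G) (z 0) (z 1) ≠ 0 := by
  intro h
  have h2 := ((soloInformed_mem_etaleCurve G z).1 hz).2
  rw [h, mul_zero] at h2
  exact zero_ne_one h2

/-- Gradient entries of `Z_G` used in the rank computation. -/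
theorem soloInformed_gradient_etaleCurve (G : K[X][X]) (z : Fin 3 → ℂ) :
    (soloInformedEtaleCurve G).gradient 0 z 1 = soloInformedEvC (Polynomial.derivative G) (z 0) (z 1) ∧
    (soloInformedEtaleCurve G).gradient 0 z 2 = 0 ∧
    (soloInformedEtaleCurve G).gradient 1 z 2 = soloInformedEvC (Polynomial.derivative G) (z 0) (z 1) := by
  refine ⟨?_, ?_, ?_⟩
  · show MvPolynomial.eval z (MvPolynomial.pderiv 1 (soloInformedToMv3 G)) = _
    rw [soloInformed_pderiv_one_toMv3, soloInformed_eval_toMv3]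
  · show MvPolynomial.eval z (MvPolynomial.pderiv 2 (soloInformedToMv3 G)) = _
    rw [soloInformed_pderiv_two_toMv3, map_zero]
  · show MvPolynomial.eval z (MvPolynomial.pderiv 2
      (MvPolynomial.X 2 * soloInformedToMv3 (Polynomial.derivative G) - 1)) = _
    rw [map_sub, Derivation.leibniz, soloInformed_pderiv_two_toMv3, smul_zero, zero_add,
      MvPolynomial.pderiv_X, Pi.single_eq_same, smul_eq_mul, mul_one, Derivation.map_one_eq_zero,
      sub_zero, soloInformed_eval_toMv3]

/-- **`Z_G` is a smooth affine curve over `ℚ̄`** (when `K` consists of algebraic numbers): rank `2`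
of the Jacobian at every point (the `x₂`-column isolates the second equation, and `∂_Y G ≠ 0`
the first), and no isolated points (holomorphic root function through every point).
[Huber–Wüstholz 2022, Def. 12.6; folklore] -/
theorem soloInformed_isSmoothAffineCurve_etaleCurve
    (hK : ∀ a : K, IsAlgebraic ℚ (algebraMap K ℂ a)) (G : K[X][X]) :
    (soloInformedEtaleCurve G).IsSmoothAffineCurve where
  algebraic j := by
    fin_cases j
    · exact soloInformed_hasAlgCoeffs_toMv3 hK G
    · exact ((hasAlgCoeffs_X 2).mul (soloInformed_hasAlgCoeffs_toMv3 hK _)).sub hasAlgCoeffs_one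
  rank_eq z hz := by
    have hβ := soloInformed_etale_of_mem hz
    obtain ⟨h01, h02, h12⟩ := soloInformed_gradient_etaleCurve G z
    have hli : LinearIndependent ℂ (fun j : Fin 2 => (soloInformedEtaleCurve G).gradient j z) := by
      have hfun : (fun j : Fin 2 => (soloInformedEtaleCurve G).gradient j z) =
          ![(soloInformedEtaleCurve G).gradient 0 z, (soloInformedEtaleCurve G).gradient 1 z] := by
        funext j
        fin_cases j <;> rfl
      rw [hfun, LinearIndependent.pair_iff]
      intro a b hab
      have h2 := congr_fun hab 2
      have h1 := congr_fun hab 1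
      simp only [Pi.add_apply, Pi.smul_apply, smul_eq_mul, Pi.zero_apply, h02, h12, h01,
        mul_zero, zero_add] at h1 h2
      have hb : b = 0 := (mul_eq_zero.1 h2).resolve_right hβ
      rw [hb, zero_mul, add_zero] at h1
      exact ⟨(mul_eq_zero.1 h1).resolve_right hβ, hb⟩
    have h := finrank_span_eq_card hli
    simpa [soloInformedEtaleCurve] using h
  not_isolated z hz := by
    obtain ⟨h0, h2⟩ := (soloInformed_mem_etaleCurve G z).1 hz
    have hβ := soloInformed_etale_of_mem hz
    obtain ⟨ρ, hρ0, hρan, hρev⟩ := exists_holomorphic_root G (s₀ := z 0) (u₀ := z 1) h0 hβ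
    set c : ℂ → Fin 3 → ℂ := fun s =>
      ![s, ρ s, (soloInformedEvC (Polynomial.derivative G) s (ρ s))⁻¹] with hc
    have hcβ : ContinuousAt (fun s => soloInformedEvC (Polynomial.derivative G) s (ρ s)) (z 0) :=
      (soloInformed_continuous_evC _).continuousAt.comp (continuousAt_id.prodMk hρan.continuousAt)
    have hcz : c (z 0) = z := by
      funext i
      fin_cases i
      · rfl
      · simpa [hc] using hρ0
      · simp only [hc, hρ0]
        exact (eq_inv_of_mul_eq_one_left h2).symm
    have hcont : ContinuousAt c (z 0) := by
      refine continuousAt_pi.2 fun i => ?_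
      fin_cases i
      · exact continuousAt_id
      · exact hρan.continuousAt
      · exact hcβ.inv₀ (by rwa [hρ0])
    have hmem : ∀ᶠ s in 𝓝 (z 0), c s ∈ (soloInformedEtaleCurve G).points := by
      filter_upwards [hρev, hcβ.eventually_ne (by rwa [hρ0])] with s hs hs'
      rw [soloInformed_mem_etaleCurve]
      exact ⟨hs, inv_mul_cancel₀ hs'⟩
    refine mem_closure_of_tendsto (f := c) (b := 𝓝[≠] (z 0))
      ((hcz ▸ hcont.tendsto).mono_left nhdsWithin_le_nhds) ?_
    filter_upwards [eventually_nhdsWithin_of_eventually_nhds hmem, self_mem_nhdsWithin] with s hs hs'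
    refine ⟨hs, fun h => hs' ?_⟩
    have := congr_fun h 0
    simpa [hc] using this

end Summit.KontsevichZagierPeriods.KontsevichZagierPeriods.Theorems
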